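import Literature.Analysis.FluidPDE.SelfSimilarProofs
import Literature.Analysis.FluidPDE.RusinSverakCompactness
import Literature.Analysis.FluidPDE.SpaceTimeRescaling
import HarnessLib

/-!
# Covariance of Kato solutions and of minimal blow-up data under scalings and translations

Analysis/FluidPDE support file, definitions-free (serves the named facts
`Literature.Analysis.FluidPDE.rusin_sverak_minimal_blowup` (`MildSolutions.lean`) and
`Literature.Analysis.FluidPDE.rusin_sverak_minimal_data_compact` (`RusinSverakCompactness.lean`), which transcribe
Rusin–Šverák, J. Funct. Anal. 260 (2011) = arXiv:0911.0500, Cor. 4.3: the set `M` of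
`Ḣ^{1/2}`-minimal singularity-generating data "is compact, modulo the action of the scalings
`u₀(x) → λ u₀(λ x)` and translations `u₀(x) → u₀(x - x₀)`" (§1, p. 3)). That `M` — and, more
basically, the property "`T_max(u₀) = ∞`", transcribed in the tree as
`NS.HasGlobalKatoSolution ν u₀` (a global mild solution in Kato's class `C([0,∞); L³)`) — is
*invariant* under these symmetries is used tacitly throughout the paper (§1 p. 3: "The
`Ḣ^{1/2}`-norm is invariant under the natural scaling"; proof of Cor. 4.3, p. 8: the rescaled
and translated data `v^k(x) = λ_k u₀^k(λ_k x - x₀^k)` are again in `M`). This file **proves**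
it for the tree's notions:

* `Fluid.IsMildNSSolutionBetween.comp_sub_right_zero`: the unforced duality identity
  (Fabes–Jones–Rivière 1972, Thm. 2.1) is invariant under space translations
  `u ↦ u(·, · - a)` (test against `φ(· + a)`; the heat flow commutes with translations,
  `Fluid.heatTest_comp_add_right`); the parabolic scaling `u ↦ c u(c² ·, c ·)` is the tree's
  `Fluid.IsMildNSSolutionBetween.nsRescale_zero` (`SelfSimilarProofs.lean`);
* `Fluid.IsWeaklyDivFree.comp_sub_right`, `Fluid.ContinuousInLpOn.comp_sub_right`,
  `NS.continuousInLpOn_three_rescale`, `Fluid.aestronglyMeasurable_comp_stAffine_Ioi`: Kato's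
  class `C([0,∞); L³(ℝ³))` + measurability is invariant (the `L³(ℝ³)` norm is scale invariant,
  `NS.eLpNorm_three_rescaleData` of `CriticalSpaces.lean`);
* `NS.HasGlobalKatoSolution.rescaleData`, `NS.HasGlobalKatoSolution.translate` and the
  equivalences `NS.hasGlobalKatoSolution_rescaleData_iff`, `NS.hasGlobalKatoSolution_translate_iff`,
  `NS.hasGlobalKatoSolution_rescaleData_translate_iff`: `u₀` has a global Kato solution iff
  `λ u₀(λ · - x₀)` has one (`λ > 0`);
* `NS.IsMinimalBlowupDatum.rescaleData_translate`: membership in Rusin–Šverák's `M`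
  (`NS.IsMinimalBlowupDatum`) passes to `λ u₀(λ · - x₀)` with any representing class of the
  same `Ḣ^{1/2}` norm (such a class exists: `RusinSverakCompactnessProofs.lean`,
  `NS.exists_represents_rescaleData_norm_eq`).

## Mathlib / tree search

Tree (`lean search 'nsRescale|rescaleData|comp_add_right'`): parabolic scaling of the duality
identity and all heat-kernel self-similarity lemmas are in `SelfSimilarProofs.lean`
(`Fluid.IsMildNSSolutionBetween.nsRescale_zero`, `Fluid.heatTest_comp_inv_smul`,
`IsTestFunctionOn.comp_smul_top`, `Fluid.IsWeaklyDivFree.nsRescaleData`); `L³` scale invariance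
in `CriticalSpaces.lean` (`NS.eLpNorm_three_rescaleData`, `NS.memLp_three_rescaleData`); the
space–time affine maps and their measure theory in `SpaceTimeRescaling.lean`
(`Fluid.map_stAffine_volume_restrict_preimage`); time translation of the duality identity in
`SelfSimilar.lean` (`IsMildNSSolutionBetween.comp_add_right`). Space translation of the duality
identity and the covariance of `HasGlobalKatoSolution` were missing. Mathlib:
`MeasureTheory.integral_sub_right_eq_self`, `MeasureTheory.eLpNorm_comp_measurePreserving`,
`MeasureTheory.measurePreserving_sub_right`, `fderiv_comp_add_right`,
`HasCompactSupport.comp_homeomorph`.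

## References

* W. Rusin, V. Šverák, *Minimal initial data for potential Navier–Stokes singularities*,
  J. Funct. Anal. 260 (2011) 879–891 = arXiv:0911.0500, §1 (p. 3: scalings and translations),
  Cor. 4.3 (p. 8).
* T. Kato, *Strong `L^p`-solutions of the Navier–Stokes equation in `ℝ^m`, with applications to
  weak solutions*, Math. Z. 187 (1984), 471–480, §1 (scale invariance of `L³(ℝ³)`).
* E. B. Fabes, B. F. Jones, N. M. Rivière, Arch. Rational Mech. Anal. 45 (1972), Thm. 2.1
  (duality form of mild solutions).
-/

noncomputable section

open MeasureTheory TopologicalSpace Set Function Filter Topology Module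
open scoped InnerProductSpace RealInnerProductSpace ENNReal NNReal

namespace Literature.Analysis.FluidPDE

/-! ### Translated test functions and the heat flow -/

section TestFunction

variable {E : Type*} [NormedAddCommGroup E] [NormedSpace ℝ E]
variable {F : Type*} [NormedAddCommGroup F] [NormedSpace ℝ F]

/-- A test function on the whole space composed with a translation `x ↦ x + a` is a test
function on the whole space (Evans, *PDE*, §5.2.1). [folklore] -/
theorem _root_.Literature.Analysis.FunctionSpaces.IsTestFunctionOn.comp_add_right_top {φ : E → F} (hφ : FunctionSpaces.IsTestFunctionOn (⊤ : Opens E) φ)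
    (a : E) : FunctionSpaces.IsTestFunctionOn (⊤ : Opens E) (fun x => φ (x + a)) where
  contDiff := hφ.contDiff.comp (contDiff_id.add contDiff_const)
  hasCompactSupport := hφ.hasCompactSupport.comp_homeomorph (Homeomorph.addRight a)
  tsupport_subset := by simp

end TestFunction

section Heat

variable {E : Type*} [NormedAddCommGroup E] [InnerProductSpace ℝ E] [FiniteDimensional ℝ E]
  [MeasurableSpace E] [BorelSpace E]
variable {F : Type*} [NormedAddCommGroup F] [NormedSpace ℝ F]

/-- **The caloric extension commutes with translations**: `e^{tΔ}(φ(· + a))(y) = (e^{tΔ}φ)(y + a)`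
(the heat kernel is a convolution kernel; Evans, *PDE*, §2.3.1). Holds for every `t`, including
the junk range, since both sides are the same integral. [folklore] -/
theorem heatExtension_comp_add_right (φ : E → F) (a : E) (t : ℝ) (y : E) :
    UnboundedOperators.heatExtension (fun x => φ (x + a)) t y = UnboundedOperators.heatExtension φ t (y + a) := by
  rw [UnboundedOperators.heatExtension_apply, UnboundedOperators.heatExtension_apply]
  congr 1
  funext z
  rw [sub_add_eq_add_sub]

/-- The heat flow `Fluid.heatFlow` commutes with translations, for every `t` (Evans, *PDE*,
§2.3.1). [folklore] -/
theorem heatFlow_comp_add_right (φ : E → F) (a : E) (t : ℝ) (y : E) :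
    FluidPDE.heatFlow (fun x => φ (x + a)) t y = FluidPDE.heatFlow φ t (y + a) := by
  rcases le_or_gt t 0 with ht | ht
  · rw [FluidPDE.heatFlow_of_nonpos _ ht, FluidPDE.heatFlow_of_nonpos _ ht]
  · rw [FluidPDE.heatFlow_of_pos _ ht, FluidPDE.heatFlow_of_pos _ ht, heatExtension_comp_add_right]

/-- The caloric test field `e^{ντΔ}φ` commutes with translations (Fabes–Jones–Rivière 1972, §2).
[folklore] -/
theorem heatTest_comp_add_right (ν : ℝ) (φ : E → F) (a : E) (τ : ℝ) (y : E) :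
    FluidPDE.heatTest ν (fun x => φ (x + a)) τ y = FluidPDE.heatTest ν φ τ (y + a) :=
  FluidPDE.heatFlow_comp_add_right φ a (ν * τ) y

end Heat

section Fluid

/-! ### Translation of divergence-free fields and of pairings -/

section Pairing

variable {E : Type*} [NormedAddCommGroup E] [InnerProductSpace ℝ E] [FiniteDimensional ℝ E]

omit [FiniteDimensional ℝ E] in
/-- A (pointwise) divergence-free field composed with a translation is divergence free
(`D(φ(· + a))(x) = Dφ(x + a)`, Mathlib `fderiv_comp_add_right`). [folklore] -/
theorem VectorCalculus.IsDivFree.comp_add_right {φ : E → E} (h : VectorCalculus.IsDivFree φ) (a : E) :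
    VectorCalculus.IsDivFree (fun x => φ (x + a)) := by
  intro x
  have hx := h (x + a)
  simp only [VectorCalculus.divergence] at hx ⊢
  rw [fderiv_comp_add_right]
  exact hx

variable [MeasurableSpace E] [BorelSpace E]

/-- **Translation of pairings**: `∫ ⟪U(x - a), Φ(x)⟫ dx = ∫ ⟪U(y), Φ(y + a)⟫ dy` (translation
invariance of Lebesgue measure, Mathlib `integral_sub_right_eq_self`; unconditional).
[folklore] -/
theorem integral_inner_comp_sub_right (U Φ : E → E) (a : E) :
    ∫ x, ⟪U (x - a), Φ x⟫ = ∫ y, ⟪U y, Φ (y + a)⟫ := by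
  have h1 : (fun x => ⟪U (x - a), Φ x⟫) = fun x => (fun y => ⟪U y, Φ (y + a)⟫) (x - a) := by
    funext x
    simp only [sub_add_cancel]
  rw [h1, integral_sub_right_eq_self (fun y => ⟪U y, Φ (y + a)⟫) a]

/-- **Weak divergence-freeness is translation invariant**: if `∫ ⟪U, ∇θ⟫ = 0` for all test
functions `θ`, the same holds for `U(· - a)` (test against `θ(· + a)`). [folklore] -/
theorem IsWeaklyDivFree.comp_sub_right {U : E → E} (h : IsWeaklyDivFree U) (a : E) :
    IsWeaklyDivFree (fun x => U (x - a)) := by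
  intro θ hθ
  have key := h (fun y => θ (y + a)) (hθ.comp_add_right_top a)
  rw [integral_inner_comp_sub_right]
  simp_rw [real_inner_gradient_right] at key ⊢
  simp_rw [fderiv_comp_add_right] at key
  exact key

end Pairing

/-! ### Translation invariance of the duality identity and of the Kato class -/

section Mild

variable {E : Type*} [NormedAddCommGroup E] [InnerProductSpace ℝ E] [FiniteDimensional ℝ E]
  [MeasurableSpace E] [BorelSpace E]

/-- **Space-translation invariance of the unforced two-time duality identity**
(Fabes–Jones–Rivière 1972, Thm. 2.1): if the identity holds for `u` between `s` and `t`, it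
holds for the translate `(τ, x) ↦ u τ (x - a)`: each term equals the corresponding term for `u`
tested against `φ(· + a)` (the heat flow commutes with translations,
`heatTest_comp_add_right`, and `D(ψ(· + a)) = (Dψ)(· + a)`). Rusin–Šverák 2011, §1: the
translations `u₀(x) → u₀(x - x₀)` are symmetries of the Cauchy problem.
[cite: RusinSverak2011, §1 (arXiv:0911.0500 p. 3, translations)] -/
theorem IsMildNSSolutionBetween.comp_sub_right_zero {ν : ℝ} {u : ℝ → E → E} {s t : ℝ} (a : E)
    (h : IsMildNSSolutionBetween ν 0 u s t) :
    IsMildNSSolutionBetween ν 0 (fun τ x => u τ (x - a)) s t := by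
  intro φ hφ hdiv
  have key := h (fun y => φ (y + a)) (hφ.comp_add_right_top a) (hdiv.comp_add_right a)
  simp only [Pi.zero_apply, inner_zero_left, integral_zero, intervalIntegral.integral_zero,
    add_zero] at key ⊢
  -- left-hand side
  have e1 : ∫ x, ⟪u t (x - a), φ x⟫ = ∫ y, ⟪u t y, φ (y + a)⟫ :=
    integral_inner_comp_sub_right _ _ _
  -- datum term
  have e2 : ∫ x, ⟪u s (x - a), heatTest ν φ (t - s) x⟫ =
      ∫ y, ⟪u s y, heatTest ν (fun y => φ (y + a)) (t - s) y⟫ := by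
    rw [integral_inner_comp_sub_right]
    simp_rw [heatTest_comp_add_right]
  -- nonlinear term, slice by slice
  have e3 : ∀ τ, ∫ x, ⟪u τ (x - a), convect (fun x => u τ (x - a)) (heatTest ν φ (t - τ)) x⟫ =
      ∫ y, ⟪u τ y, convect (u τ) (heatTest ν (fun y => φ (y + a)) (t - τ)) y⟫ := by
    intro τ
    have hW : heatTest ν (fun y => φ (y + a)) (t - τ) = fun y => heatTest ν φ (t - τ) (y + a) := by
      funext y
      exact heatTest_comp_add_right ν φ a (t - τ) y
    have h1 : (fun x => ⟪u τ (x - a), convect (fun x => u τ (x - a)) (heatTest ν φ (t - τ)) x⟫) =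
        fun x => (fun y => ⟪u τ y,
          convect (u τ) (heatTest ν (fun y => φ (y + a)) (t - τ)) y⟫) (x - a) := by
      funext x
      simp only [convect, hW, fderiv_comp_add_right, sub_add_cancel]
    rw [h1, integral_sub_right_eq_self
      (fun y => ⟪u τ y, convect (u τ) (heatTest ν (fun y => φ (y + a)) (t - τ)) y⟫) a]
  simp_rw [e3]
  rw [e1, e2, key]

variable {F : Type*} [NormedAddCommGroup F]

/-- `C(S; L^p)` is invariant under space translations `u ↦ u(·, · - a)` (Lebesgue measure is
translation invariant; Kato 1984, §1). [folklore] -/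
theorem ContinuousInLpOn.comp_sub_right {S : Set ℝ} {p : ℝ≥0∞} {u : ℝ → E → F}
    (h : ContinuousInLpOn S p u) (a : E) : ContinuousInLpOn S p (fun t x => u t (x - a)) := by
  have hmp : MeasurePreserving (fun x : E => x - a) volume volume :=
    measurePreserving_sub_right volume a
  refine ⟨fun t ht => (h.1 t ht).comp_measurePreserving hmp, fun t₀ ht₀ => ?_⟩
  refine (h.2 t₀ ht₀).congr' ?_
  filter_upwards [eventually_mem_nhdsWithin] with t ht
  have h1 : ((fun x => u t (x - a)) - fun x => u t₀ (x - a)) = (u t - u t₀) ∘ fun x => x - a := rfl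
  rw [h1, eLpNorm_comp_measurePreserving
    ((h.1 t ht).sub (h.1 t₀ ht₀)).aestronglyMeasurable hmp]

/-- Space–time measurability on `(0, ∞) × E` is transported by the affine maps
`(s, y) ↦ (β s, x₀ + γ y)` (`β, γ > 0`), which are quasi-measure-preserving bijections of
`(0, ∞) × E` (`Fluid.map_stAffine_volume_restrict_preimage`). [folklore] -/
theorem aestronglyMeasurable_comp_stAffine_Ioi {β γ : ℝ} (hβ : 0 < β) (hγ : 0 < γ) (x₀ : E)
    {G : ℝ × E → F}
    (hG : AEStronglyMeasurable G (volume.restrict (Ioi (0 : ℝ) ×ˢ (univ : Set E)))) :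
    AEStronglyMeasurable (G ∘ stAffine β γ 0 x₀)
      (volume.restrict (Ioi (0 : ℝ) ×ˢ (univ : Set E))) := by
  have hpre : stAffine β γ 0 x₀ ⁻¹' (Ioi (0 : ℝ) ×ˢ (univ : Set E)) = Ioi 0 ×ˢ univ := by
    ext ⟨s, y⟩
    simp [stAffine, hβ]
  have hq : Measure.QuasiMeasurePreserving (stAffine β γ 0 x₀)
      (volume.restrict (Ioi (0 : ℝ) ×ˢ (univ : Set E)))
      (volume.restrict (Ioi (0 : ℝ) ×ˢ (univ : Set E))) := by
    refine ⟨measurable_stAffine _ _ _ _, ?_⟩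
    have hmap := map_stAffine_volume_restrict_preimage hβ hγ 0 x₀ (Ioi (0 : ℝ) ×ˢ (univ : Set E))
    rw [hpre] at hmap
    rw [hmap]
    exact Measure.smul_absolutelyContinuous
  exact hG.comp_quasiMeasurePreserving hq

end Mild

end Fluid

section NS

/-! ### The Kato class `C([0,∞); L³(ℝ³))` under the parabolic scaling -/

/-- `C(S; L³(ℝ³))` is invariant under the parabolic scaling `u ↦ c u(c² ·, c ·)` (`c > 0`,
`NS.rescale`) when `t ↦ c² t` maps `S'` into `S`: the `L³(ℝ³)` norm is scale invariant
(`eLpNorm_three_rescaleData`; Kato 1984, §1). [cite: Kato1984, §1] -/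
theorem continuousInLpOn_three_rescale {S S' : Set ℝ}
    {u : ℝ → EuclideanSpace ℝ (Fin 3) → EuclideanSpace ℝ (Fin 3)}
    (h : FluidPDE.ContinuousInLpOn S 3 u) {c : ℝ} (hc : 0 < c)
    (hS : MapsTo (fun t => c ^ 2 * t) S' S) : FluidPDE.ContinuousInLpOn S' 3 (FluidPDE.rescale c u) := by
  refine ⟨fun t ht => ?_, fun t₀ ht₀ => ?_⟩
  · have h1 : FluidPDE.rescale c u t = FluidPDE.rescaleData c (u (c ^ 2 * t)) := rfl
    rw [h1]
    exact memLp_three_rescaleData (h.1 _ (hS ht)) hc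
  · have hmap : Tendsto (fun t => c ^ 2 * t) (𝓝[S'] t₀) (𝓝[S] (c ^ 2 * t₀)) :=
      (continuous_const_mul _).continuousWithinAt.tendsto_nhdsWithin hS
    refine ((h.2 (c ^ 2 * t₀) (hS ht₀)).comp hmap).congr fun t => ?_
    simp only [Function.comp_apply]
    have h1 : FluidPDE.rescale c u t - FluidPDE.rescale c u t₀ =
        FluidPDE.rescaleData c (u (c ^ 2 * t) - u (c ^ 2 * t₀)) := by
      funext x
      simp [FluidPDE.rescaleData, smul_sub]
    rw [h1, eLpNorm_three_rescaleData _ hc]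

/-! ### Global Kato solutions under scalings and translations -/

/-- **Scale invariance of `T_max = ∞`**: if `u₀` has a global Kato solution `u`
(`C([0,∞); L³)` mild solution, `u(0) = u₀`), then so has the rescaled datum
`c u₀(c ·)` (`NS.rescaleData c u₀`, `c > 0`), namely `c u(c² ·, c ·)` (`NS.rescale c u`): the
duality identity is scale invariant (`Fluid.IsMildNSSolutionBetween.nsRescale_zero`), as are
weak divergence-freeness, the Kato class and measurability. Rusin–Šverák 2011, §1: "The
`Ḣ^{1/2}`-norm is invariant under the natural scaling of the initial data `u₀(x) → λ u₀(λx)`"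
— and so is `T_max(u₀) = ∞`. [cite: RusinSverak2011, §1 (arXiv:0911.0500 p. 3, scaling)] -/
theorem HasGlobalKatoSolution.rescaleData {ν : ℝ}
    {u₀ : EuclideanSpace ℝ (Fin 3) → EuclideanSpace ℝ (Fin 3)} (h : HasGlobalKatoSolution ν u₀)
    {c : ℝ} (hc : 0 < c) : HasGlobalKatoSolution ν (FluidPDE.rescaleData c u₀) := by
  obtain ⟨u, hu, hcont, h0, hmeas⟩ := h
  have hS : MapsTo (fun t => c ^ 2 * t) (Ici (0 : ℝ)) (Ici 0) := fun _ ht =>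
    mem_Ici.2 (mul_nonneg (sq_nonneg c) (mem_Ici.1 ht))
  refine ⟨FluidPDE.rescale c u, ⟨fun t ht => ?_, fun t ht => ?_⟩,
    continuousInLpOn_three_rescale hcont hc hS, ?_, ?_⟩
  · exact (hu.1 (c ^ 2 * t) (hS ht)).nsRescaleData hc
  · have h2 : FluidPDE.IsMildNSSolutionBetween ν 0 u 0 (c ^ 2 * t) := by
      rw [← FluidPDE.isMildNSSolutionFrom_self_iff, h0]
      exact hu.2 (c ^ 2 * t) (hS ht)
    have h3 : FluidPDE.IsMildNSSolutionBetween ν 0 u (c ^ 2 * 0) (c ^ 2 * t) := by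
      rwa [mul_zero]
    rw [← h0, ← FluidPDE.rescale_zero]
    exact FluidPDE.isMildNSSolutionFrom_self_iff.2 (IsMildNSSolutionBetween.nsRescale_zero hc h3)
  · funext x
    simp [h0]
  · have h1 : uncurry (FluidPDE.rescale c u) =
        fun z => c • (uncurry u ∘ FluidPDE.stAffine (c ^ 2) c 0 (0 : EuclideanSpace ℝ (Fin 3))) z := by
      funext ⟨s, y⟩
      simp [FluidPDE.stAffine]
    rw [h1]
    exact (FluidPDE.aestronglyMeasurable_comp_stAffine_Ioi (pow_pos hc 2) hc 0 hmeas).const_smul c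

/-- **Translation invariance of `T_max = ∞`**: if `u₀` has a global Kato solution `u`, then so
has `u₀(· - a)`, namely `u(·, · - a)` (Rusin–Šverák 2011, §1: translations `u₀(x) → u₀(x - x₀)`
are symmetries). [cite: RusinSverak2011, §1 (arXiv:0911.0500 p. 3, translations)] -/
theorem HasGlobalKatoSolution.translate {ν : ℝ}
    {u₀ : EuclideanSpace ℝ (Fin 3) → EuclideanSpace ℝ (Fin 3)} (h : HasGlobalKatoSolution ν u₀)
    (a : EuclideanSpace ℝ (Fin 3)) : HasGlobalKatoSolution ν (fun x => u₀ (x - a)) := by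
  obtain ⟨u, hu, hcont, h0, hmeas⟩ := h
  refine ⟨fun t x => u t (x - a), ⟨fun t ht => (hu.1 t ht).comp_sub_right a, fun t ht => ?_⟩,
    hcont.comp_sub_right a, ?_, ?_⟩
  · have h2 : FluidPDE.IsMildNSSolutionBetween ν 0 u 0 t := by
      rw [← FluidPDE.isMildNSSolutionFrom_self_iff, h0]
      exact hu.2 t ht
    rw [← h0]
    exact FluidPDE.isMildNSSolutionFrom_self_iff.2 (h2.comp_sub_right_zero a)
  · funext x
    simp [h0]
  · have h1 : uncurry (fun t x => u t (x - a)) = uncurry u ∘ FluidPDE.stAffine 1 1 0 (-a) := by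
      funext ⟨s, y⟩
      simp [FluidPDE.stAffine, neg_add_eq_sub]
    rw [h1]
    exact FluidPDE.aestronglyMeasurable_comp_stAffine_Ioi one_pos one_pos (-a) hmeas

/-- `c u₀(c ·)` has a global Kato solution iff `u₀` has one (`c > 0`; apply
`HasGlobalKatoSolution.rescaleData` with `c` and `c⁻¹`).
[cite: RusinSverak2011, §1 (arXiv:0911.0500 p. 3, scaling)] -/
theorem hasGlobalKatoSolution_rescaleData_iff {ν : ℝ}
    {u₀ : EuclideanSpace ℝ (Fin 3) → EuclideanSpace ℝ (Fin 3)} {c : ℝ} (hc : 0 < c) :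
    HasGlobalKatoSolution ν (FluidPDE.rescaleData c u₀) ↔ HasGlobalKatoSolution ν u₀ := by
  refine ⟨fun h => ?_, fun h => h.rescaleData hc⟩
  have h1 := h.rescaleData (inv_pos.2 hc)
  rwa [← FluidPDE.rescaleData_mul, mul_inv_cancel₀ hc.ne', FluidPDE.rescaleData_one] at h1

/-- `u₀(· - a)` has a global Kato solution iff `u₀` has one (apply
`HasGlobalKatoSolution.translate` with `a` and `-a`).
[cite: RusinSverak2011, §1 (arXiv:0911.0500 p. 3, translations)] -/
theorem hasGlobalKatoSolution_translate_iff {ν : ℝ}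
    {u₀ : EuclideanSpace ℝ (Fin 3) → EuclideanSpace ℝ (Fin 3)} (a : EuclideanSpace ℝ (Fin 3)) :
    HasGlobalKatoSolution ν (fun x => u₀ (x - a)) ↔ HasGlobalKatoSolution ν u₀ := by
  refine ⟨fun h => ?_, fun h => h.translate a⟩
  have h1 := h.translate (-a)
  simpa [sub_neg_eq_add] using h1

/-- **`T_max = ∞` is invariant under the Rusin–Šverák symmetries**: `λ u₀(λ · - x₀)`
(`NS.rescaleData λ (u₀ (· - x₀))`, `λ > 0`) has a global Kato solution iff `u₀` has one
(Rusin–Šverák 2011, §1 and Cor. 4.3: `M` is invariant under scalings and translations).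
[cite: RusinSverak2011, §1 (arXiv:0911.0500 p. 3, scalings and translations)] -/
theorem hasGlobalKatoSolution_rescaleData_translate_iff {ν : ℝ}
    {u₀ : EuclideanSpace ℝ (Fin 3) → EuclideanSpace ℝ (Fin 3)} {c : ℝ} (hc : 0 < c)
    (x₀ : EuclideanSpace ℝ (Fin 3)) :
    HasGlobalKatoSolution ν (FluidPDE.rescaleData c fun x => u₀ (x - x₀)) ↔
      HasGlobalKatoSolution ν u₀ := by
  rw [hasGlobalKatoSolution_rescaleData_iff hc, hasGlobalKatoSolution_translate_iff]

/-! ### Invariance of Rusin–Šverák's set `M` of minimal blow-up data -/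

/-- **Rusin–Šverák's set `M` is invariant under scalings and translations** (for the tree's
transcription `NS.IsMinimalBlowupDatum`, `RusinSverakCompactness.lean`): if `(u₀, g)` is an
`Ḣ^{1/2}`-minimal blow-up datum for viscosity `ν` and `g' ∈ Ḣ^{1/2}` is a class of the same norm
representing the modulated datum `λ u₀(λ · - x₀)` (`λ > 0`; such a class always exists, with
`g'(ξ) = λ⁻² e^{-2πi⟨x₀,ξ⟩/λ} g(ξ/λ)`), then `(λ u₀(λ · - x₀), g')` is again a minimal blow-up
datum: `L³` and weak divergence-freeness are preserved (`memLp_three_rescaleData`,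
`Fluid.IsWeaklyDivFree.nsRescaleData`, `.comp_sub_right`) and `T_max < ∞` is invariant
(`hasGlobalKatoSolution_rescaleData_translate_iff`). Rusin–Šverák 2011, Cor. 4.3 (p. 8): the
normalised sequence `v^k(x) = λ_k u₀^k(λ_k x - x₀^k)` stays in `M`.
[cite: RusinSverak2011, Cor. 4.3 (arXiv:0911.0500 p. 8) with §1 (p. 3)] -/
theorem IsMinimalBlowupDatum.rescaleData_translate {ν : ℝ}
    {u₀ : EuclideanSpace ℝ (Fin 3) → EuclideanSpace ℝ (Fin 3)}
    {g g' : FunctionSpaces.HomSobolev (EuclideanSpace ℝ (Fin 3)) (EuclideanSpace ℂ (Fin 3)) (1 / 2 : ℝ)}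
    (h : IsMinimalBlowupDatum ν u₀ g) {c : ℝ} (hc : 0 < c) (x₀ : EuclideanSpace ℝ (Fin 3))
    (hg' : g'.Represents (FunctionSpaces.EuclideanSpace.complexify ∘ FluidPDE.rescaleData c (fun x => u₀ (x - x₀))))
    (hnorm : ‖g'‖ = ‖g‖) :
    IsMinimalBlowupDatum ν (FluidPDE.rescaleData c fun x => u₀ (x - x₀)) g' := by
  obtain ⟨h3, -, hdiv, hρ, hblow⟩ := h
  refine ⟨memLp_three_rescaleData
    (h3.comp_measurePreserving (measurePreserving_sub_right volume x₀)) hc, hg',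
    (hdiv.comp_sub_right x₀).nsRescaleData hc, ?_,
    fun hK => hblow ((hasGlobalKatoSolution_rescaleData_translate_iff hc x₀).1 hK)⟩
  rw [← hρ, ← ofReal_norm, ← ofReal_norm, hnorm]

end NS

end Literature.Analysis.FluidPDE
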